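import Summits.NavierStokesRegularity.FunctionalMining.TopEigWeightedBalance
import Summits.NavierStokesRegularity.FunctionalMining.TopEigRayleighSpectral
import Summits.NavierStokesRegularity.FunctionalMining.StrainMomentRateSupAll
import HarnessLib

/-!
# FunctionalMining — K0 rows `ES.lam1.q|T_C|C1` and `ES.neglam3.q|T_C|C1` in the kernel, every real `q > 1`

Search for candidate a priori estimates; no regularity claim. Cell `pub-nsfunc`, prove seat
(gen 16). CLOSES the located gap of DERIVATIVES §29 for the `λ₁` core of family `ES`
(`StrainEigen.lean`: "`lam1` rows HOLD for `1 < q < ∞` by the CZ-closure N8 plus coercivity — sketch,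
UNREVIEWED"; the missing piece was a balance law for the NON-SMOOTH convex spectral weight
`S ↦ λ₁(S)^q`). The dictionary row is in MAJORANT form (`FunctionalRateSupBound`): along every
classical solution of unforced Navier–Stokes/Euler (`ν ≥ 0`) on `T³ × [a, b]`, at every time `t` with
`|ω(t,·)|² ≤ M²`, every one-sided derivative value `R` of `s ↦ ∫ (λ₁⁺)^q (S(u s))` within `[a, b]`
satisfies `R ≤ C M ∫ (λ₁⁺)^q (S(u t))`.

Proof (no derivative of the non-smooth functional is ever taken): `λ₁ = TopEig.lam ∘ strainFlat`
(top Rayleigh value; `TopEigRayleighSpectral`), `λ₁ ≥ 0` on divergence-free fields; for the smooth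
convex regularisation `W_ε = (φ̃_ε ⋆ λ + 2ε)^q` (`TopEigWeight`) the moment `F_ε = ∫ W_ε(S)` obeys
`Ḟ_ε ≤ C(M+δ)F_ε` on a window around `t` (`TopEig.weight_hasDerivWithinAt_le` + tube lemma), hence
`F_ε(s₂) ≤ e^{C(M+δ)(s₂−s₁)}F_ε(s₁)` (Grönwall by monotonicity, `StrainMoment.exp_bound_of_deriv_le`);
the sandwich `λ₁^q ≤ W_ε ≤ (λ₁+3ε)^q` and `ε → 0⁺` transfer the exponential bounds to
`F = ∫λ₁^q`; slopes (`StrainMoment.le_of_exp_bounds`) give `R ≤ C(M+δ)F(t)` for every `δ > 0`.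
Constant `C = q((6^q K₃)^{1/q} + (9^q C_P 6^q K₃)^{1/q})` (existential CZ constants, coercivity
`|S| ≤ 6λ₁`). CONTROL rows (closing needs `∫‖ω‖_∞ < ∞`, BKM). The argument is run ONCE for an
ADMISSIBLE density `g` (convex, `1`-Lipschitz, non-negative and coercive on divergence-free strains;
`functionalRateSupBound_of_admissible`) and instantiated at `g = λ₁` (`TopEigMomentRateSupBound`)
and `g = λ₁ ∘ (−·) = −λ₃` (`NegBotEigMomentRateSupBound`). [ours]
-/

noncomputable section

open MeasureTheory Set Filter Topology Finset
open scoped InnerProductSpace RealInnerProductSpace ContDiff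

namespace Summit.NavierStokesRegularity.FunctionalMining

open Literature.Analysis.FunctionSpaces Literature.Analysis.FluidPDE

namespace TopEig

open StrainL4 StrainMoment VorticityL4 StrainTensor

/-- The normed bump of radii `ε/2 < ε` on `ℝ^{3×3}`. [ours, bookkeeping] -/
def bumpOf (ε : ℝ) (hε : 0 < ε) : ContDiffBump (0 : EuclideanSpace ℝ (Fin 3 × Fin 3)) :=
  ⟨ε / 2, ε, half_pos hε, half_lt_self hε⟩

/-- The outer radius of `bumpOf ε` is `ε`. [ours] -/
@[simp] theorem bumpOf_rOut (ε : ℝ) (hε : 0 < ε) : (bumpOf ε hε).rOut = ε := rfl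

/-- `∫ (λ₁⁺)^q = ∫ λ(S)^q` for divergence-free fields on `T³` (`λ₁ = λ ∘ strainFlat ≥ 0`). [ours] -/
theorem torusTopEigMoment_eq {v : UnitAddTorus (Fin 3) → EuclideanSpace ℝ (Fin 3)}
    (hv : Torus.IsSmooth v) (hdiv : Torus.IsDivFree v) (q : ℝ) :
    torusTopEigMoment q v = ∫ x, lam (strainFlat v x) ^ q := by
  unfold torusTopEigMoment
  refine integral_congr_ae (ae_of_all _ fun x => ?_)
  show max (torusStrainTopEig v x) 0 ^ q = lam (strainFlat v x) ^ q
  rw [← lam_strainFlat v x, max_eq_left (lam_strainFlat_nonneg hv hdiv x)]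

/-- `∫ ((−λ₃)⁺)^q = ∫ λ(−S)^q` for divergence-free fields on `T³`. [ours] -/
theorem torusNegBotEigMoment_eq {v : UnitAddTorus (Fin 3) → EuclideanSpace ℝ (Fin 3)}
    (hv : Torus.IsSmooth v) (hdiv : Torus.IsDivFree v) (q : ℝ) :
    torusNegBotEigMoment q v = ∫ x, lam (-strainFlat v x) ^ q := by
  unfold torusNegBotEigMoment
  refine integral_congr_ae (ae_of_all _ fun x => ?_)
  show max (-torusStrainBotEig v x) 0 ^ q = lam (-strainFlat v x) ^ q
  rw [← lam_neg_strainFlat v x, max_eq_left (lam_neg_strainFlat_nonneg hv hdiv x)]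

/-- **The rate bound for an admissible density (generic form).** For `g : ℝ^{3×3} → ℝ` convex and
`1`-Lipschitz, non-negative and coercive (`|S| ≤ 6 g(S)`) on the strains of smooth divergence-free
fields, and any functional `Φ` that equals `v ↦ ∫ g(S_v)^q` on such fields, `∃ C ≥ 0,
FunctionalRateSupBound Φ C` on `T³` (every real `q > 1`; module docstring). [ours] -/
theorem functionalRateSupBound_of_admissible {q : ℝ} (hq : 1 < q)
    {g : EuclideanSpace ℝ (Fin 3 × Fin 3) → ℝ} (hconv : ConvexOn ℝ univ g) (hlip : LipschitzWith 1 g)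
    (hg0 : ∀ v : UnitAddTorus (Fin 3) → EuclideanSpace ℝ (Fin 3), Torus.IsSmooth v →
      Torus.IsDivFree v → ∀ x, 0 ≤ g (strainFlat v x))
    (hg6 : ∀ v : UnitAddTorus (Fin 3) → EuclideanSpace ℝ (Fin 3), Torus.IsSmooth v →
      Torus.IsDivFree v → ∀ x, ‖strainFlat v x‖ ≤ 6 * g (strainFlat v x))
    {Φ : (UnitAddTorus (Fin 3) → EuclideanSpace ℝ (Fin 3)) → ℝ}
    (hΦ : ∀ v : UnitAddTorus (Fin 3) → EuclideanSpace ℝ (Fin 3), Torus.IsSmooth v →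
      Torus.IsDivFree v → Φ v = ∫ x, g (strainFlat v x) ^ q) :
    ∃ C : ℝ, 0 ≤ C ∧ FunctionalRateSupBound (d := Fin 3) Φ C := by
  obtain ⟨K₃, hK₃0, hK₃⟩ := exists_gradMoment_le_sup_mul_of_one_lt hq
  obtain ⟨CP, hCP0, hCP⟩ := exists_hess_rpow (d := Fin 3) (q := q) hq
  have hq0 : 0 < q := by linarith
  obtain ⟨C, hC⟩ : ∃ C : ℝ, C = q * ((((6 : ℝ) ^ q * K₃) ^ (1 / q)) +
      ((9 : ℝ) ^ q * CP * ((6 : ℝ) ^ q * K₃)) ^ (1 / q)) := ⟨_, rfl⟩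
  have hC0 : 0 ≤ C := by rw [hC]; positivity
  refine ⟨C, hC0, ?_⟩
  intro _ ν hν a b hab u p hsol t ht M hM hω R hR
  have hu : Torus.IsSmoothSpaceTimeOn (Icc a b) u := hsol.smooth_velocity
  -- the functional along the solution
  have hgc : Continuous g := hlip.continuous
  set f : ℝ → ℝ := fun s => Φ (u s) with hfdef
  have hfeq : ∀ τ ∈ Icc a b, f τ = ∫ x, g (strainFlat (u τ) x) ^ q := fun τ hτ =>
    hΦ (u τ) (hu.isSmooth_slice hτ) (hsol.divFree τ hτ)
  have hF0 : 0 ≤ f t := by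
    rw [hfeq t ht]
    exact integral_nonneg fun x => Real.rpow_nonneg (hg0 _ (hu.isSmooth_slice ht) (hsol.divFree t ht) x) _
  change R ≤ C * M * f t
  -- reduction to `R ≤ C (M + δ) f(t)` for every `δ > 0`
  suffices key : ∀ δ : ℝ, 0 < δ → R ≤ C * (M + δ) * f t by
    refine le_of_forall_pos_le_add fun e he => ?_
    have hden : 0 < C * f t + 1 := by positivity
    have h := key (e / (C * f t + 1)) (div_pos he hden)
    have h3 : C * f t / (C * f t + 1) ≤ 1 := by rw [div_le_one hden]; linarith
    have h2 : C * (e / (C * f t + 1)) * f t ≤ e := by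
      have e1 : C * (e / (C * f t + 1)) * f t = e * (C * f t / (C * f t + 1)) := by
        rw [mul_div_assoc', div_mul_eq_mul_div, mul_div_assoc']
        congr 1; ring
      rw [e1]
      calc e * (C * f t / (C * f t + 1)) ≤ e * 1 := mul_le_mul_of_nonneg_left h3 he.le
        _ = e := mul_one e
    calc R ≤ C * (M + e / (C * f t + 1)) * f t := h
      _ = C * M * f t + C * (e / (C * f t + 1)) * f t := by ring
      _ ≤ C * M * f t + e := by linarith
  intro δ hδ
  -- Step 1: a window `J = [a', b'] ∋ t` on which `|ω|² ≤ (M + δ)²`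
  have hU : UniqueDiffOn ℝ (Icc a b) := uniqueDiffOn_Icc hab
  have hQst : Torus.IsSmoothSpaceTimeOn (Icc a b) (fun s y => torusVorticitySqAt (u s) y) := by
    have h : Torus.IsSmoothSpaceTimeOn (Icc a b) (fun s y => ∑ i, ∑ j,
        (Torus.partialDeriv i (u s) y j - Torus.partialDeriv j (u s) y i) ^ 2) :=
      Torus.IsSmoothSpaceTimeOn.sum fun i _ => Torus.IsSmoothSpaceTimeOn.sum fun j _ =>
        ContDiffOn.pow (((hu.partialDeriv hU i).apply j).sub ((hu.partialDeriv hU j).apply i)) 2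
    have hfun : (fun s y => torusVorticitySqAt (u s) y) = fun s y => (2⁻¹ : ℝ) • ∑ i, ∑ j,
        (Torus.partialDeriv i (u s) y j - Torus.partialDeriv j (u s) y i) ^ 2 := by
      funext s y; rfl
    rw [hfun]
    exact h.const_smul (2⁻¹ : ℝ)
  have he0 : 0 < δ * (2 * M + δ) := by positivity
  obtain ⟨η, hη, hηP⟩ := Metric.mem_nhdsWithin_iff.1 (hQst.eventually_norm_sub_lt ht he0)
  obtain ⟨a', ha'⟩ : ∃ a' : ℝ, a' = max a (t - η / 2) := ⟨_, rfl⟩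
  obtain ⟨b', hb'⟩ : ∃ b' : ℝ, b' = min b (t + η / 2) := ⟨_, rfl⟩
  have hta' : a' ≤ t := by rw [ha']; exact max_le ht.1 (by linarith)
  have htb' : t ≤ b' := by rw [hb']; exact le_min ht.2 (by linarith)
  have ha'b' : a' < b' := by
    rcases lt_or_eq_of_le ht.2 with htb | htb
    · have : t < b' := by rw [hb']; exact lt_min htb (by linarith)
      linarith
    · have hat : a < t := by rw [htb]; exact hab
      have : a' < t := by rw [ha']; exact max_lt hat (by linarith)
      linarith
  have hJsub : Icc a' b' ⊆ Icc a b := by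
    rw [ha', hb']; exact Icc_subset_Icc (le_max_left _ _) (min_le_left _ _)
  have htJ : t ∈ Icc a' b' := ⟨hta', htb'⟩
  have hJω : ∀ τ ∈ Icc a' b', ∀ x, torusVorticitySqAt (u τ) x ≤ (M + δ) ^ 2 := by
    intro τ hτ x
    have hdist : dist τ t < η := by
      rw [Real.dist_eq, abs_lt]
      have h1 : t - η / 2 ≤ τ := le_trans (by rw [ha']; exact le_max_right _ _) hτ.1
      have h2 : τ ≤ t + η / 2 := le_trans hτ.2 (by rw [hb']; exact min_le_right _ _)
      constructor <;> linarith
    have h' : ∀ y, ‖torusVorticitySqAt (u τ) y - torusVorticitySqAt (u t) y‖ < δ * (2 * M + δ) :=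
      hηP ⟨hdist, hJsub hτ⟩
    have h := h' x
    rw [Real.norm_eq_abs, abs_lt] at h
    have h2 := hω x
    nlinarith [h.2, h2]
  have hJmem : Icc a' b' ∈ 𝓝[Icc a b] t := by
    have h1 : Icc a b ∩ Metric.ball t (η / 2) ∈ 𝓝[Icc a b] t :=
      inter_mem_nhdsWithin _ (Metric.ball_mem_nhds t (half_pos hη))
    refine mem_of_superset h1 fun s hs => ?_
    have hd : dist s t < η / 2 := hs.2
    rw [Real.dist_eq, abs_lt] at hd
    rw [ha', hb']
    exact ⟨max_le hs.1.1 (by linarith), le_min hs.1.2 (by linarith)⟩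
  -- Step 2: the solution on `J` and `Ḟ_ε ≤ C(M+δ)F_ε` there
  have hsolJ := hsol.mono hJsub (uniqueDiffOn_Icc ha'b')
  have hMδ : 0 ≤ M + δ := by linarith
  have hreg : ∀ ε : ℝ, ∀ hε : 0 < ε, ∀ τ ∈ Icc a' b', ∃ D : ℝ,
      HasDerivWithinAt (fun s => ∫ x, weight (bumpOf ε hε) g q (strainFlat (u s) x)) D (Icc a' b') τ ∧
        D ≤ C * (M + δ) * ∫ x, weight (bumpOf ε hε) g q (strainFlat (u τ) x) := by
    intro ε hε τ hτ
    obtain ⟨D, hD, hle⟩ := weight_hasDerivWithinAt_le hq hK₃0 hK₃ hCP0 ha'b' hν hsolJ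
      (fun s hs i j => hCP hab hsol s (hJsub hs) i j) hMδ hJω hconv hlip hg0 hg6 (bumpOf ε hε) hτ
    refine ⟨D, hD, ?_⟩
    rw [hC]
    exact hle
  -- Step 3: Grönwall for `F_ε` on `J`, the sandwich, `ε → 0⁺`
  have hlamc : ∀ τ ∈ Icc a b, Continuous fun x => g (strainFlat (u τ) x) := fun τ hτ =>
    hgc.comp (continuous_strainFlat (hu.isSmooth_slice hτ))
  have hlam0 : ∀ τ ∈ Icc a b, ∀ x, 0 ≤ g (strainFlat (u τ) x) := fun τ hτ x =>
    hg0 _ (hu.isSmooth_slice hτ) (hsol.divFree τ hτ) x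
  -- upper majorant `U_ε(τ) = ∫ (λ + 3ε)^q`, continuous in `ε`, equal to `f τ` at `ε = 0`
  have hcont : ∀ τ ∈ Icc a b, Continuous fun ε : ℝ =>
      ∫ x, (g (strainFlat (u τ) x) + 3 * ε) ^ q := by
    intro τ hτ
    have h := continuous_integral_add_rpow (hlamc τ hτ) (r := q) hq0.le
    exact h.comp (continuous_const.mul continuous_id)
  have hU0 : ∀ τ ∈ Icc a b, (∫ x, (g (strainFlat (u τ) x) + 3 * 0) ^ q) = f τ := by
    intro τ hτ; rw [hfeq τ hτ]; simp
  -- sandwich at a time `τ ∈ [a, b]`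
  have hlow : ∀ ε : ℝ, ∀ hε : 0 < ε, ∀ τ ∈ Icc a b,
      f τ ≤ ∫ x, weight (bumpOf ε hε) g q (strainFlat (u τ) x) := by
    intro ε hε τ hτ
    rw [hfeq τ hτ]
    have hc : Continuous fun x => weight (bumpOf ε hε) g q (strainFlat (u τ) x) :=
      ((contDiff_lamReg (bumpOf ε hε) hgc).continuous.comp
        (continuous_strainFlat (hu.isSmooth_slice hτ))).rpow_const fun x => Or.inr hq0.le
    exact integral_mono_of_nonneg (ae_of_all _ fun x => Real.rpow_nonneg (hlam0 τ hτ x) _)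
      hc.integrable_unitAddTorus
      (ae_of_all _ fun x => (weight_mem_Icc (bumpOf ε hε) hlip hq0.le (hlam0 τ hτ x)).1)
  have hupp : ∀ ε : ℝ, ∀ hε : 0 < ε, ∀ τ ∈ Icc a b,
      (∫ x, weight (bumpOf ε hε) g q (strainFlat (u τ) x)) ≤
        ∫ x, (g (strainFlat (u τ) x) + 3 * ε) ^ q := by
    intro ε hε τ hτ
    have hc : Continuous fun x => (g (strainFlat (u τ) x) + 3 * ε) ^ q :=
      ((hlamc τ hτ).add continuous_const).rpow_const fun x => Or.inr hq0.le
    refine integral_mono_of_nonneg (ae_of_all _ fun x => ?_) hc.integrable_unitAddTorus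
      (ae_of_all _ fun x => ?_)
    · exact weight_nonneg (bumpOf ε hε) q
        (mem_posSet_of_nonneg (bumpOf ε hε) hlip (hlam0 τ hτ x)).1
    · have h := (weight_mem_Icc (bumpOf ε hε) hlip hq0.le (hlam0 τ hτ x)).2
      simpa only [bumpOf_rOut] using h
  have hup : ∀ s ∈ Icc a' b', t ≤ s → f s ≤ Real.exp (C * (M + δ) * (s - t)) * f t := by
    intro s hs hts
    have h := le_of_forall_pos_le_of_continuousAt (A := fun _ => f s)
      (B := fun ε => Real.exp (C * (M + δ) * (s - t)) * ∫ x, (g (strainFlat (u t) x) + 3 * ε) ^ q)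
      continuousAt_const (continuous_const.mul (hcont t ht)).continuousAt
      (fun ε hε _ => by
        have h1 := exp_bound_of_deriv_le ha'b' (hreg ε hε) htJ hs hts
        have hexp : 0 < Real.exp (C * (M + δ) * (s - t)) := Real.exp_pos _
        calc f s ≤ ∫ x, weight (bumpOf ε hε) g q (strainFlat (u s) x) := hlow ε hε s (hJsub hs)
          _ ≤ Real.exp (C * (M + δ) * (s - t)) * ∫ x, weight (bumpOf ε hε) g q (strainFlat (u t) x) := h1
          _ ≤ Real.exp (C * (M + δ) * (s - t)) * ∫ x, (g (strainFlat (u t) x) + 3 * ε) ^ q :=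
              mul_le_mul_of_nonneg_left (hupp ε hε t ht) hexp.le)
    simpa only [hU0 t ht] using h
  have hdown : ∀ s ∈ Icc a' b', s ≤ t → f t ≤ Real.exp (C * (M + δ) * (t - s)) * f s := by
    intro s hs hst
    have h := le_of_forall_pos_le_of_continuousAt (A := fun _ => f t)
      (B := fun ε => Real.exp (C * (M + δ) * (t - s)) * ∫ x, (g (strainFlat (u s) x) + 3 * ε) ^ q)
      continuousAt_const (continuous_const.mul (hcont s (hJsub hs))).continuousAt
      (fun ε hε _ => by
        have h1 := exp_bound_of_deriv_le ha'b' (hreg ε hε) hs htJ hst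
        have hexp : 0 < Real.exp (C * (M + δ) * (t - s)) := Real.exp_pos _
        calc f t ≤ ∫ x, weight (bumpOf ε hε) g q (strainFlat (u t) x) := hlow ε hε t ht
          _ ≤ Real.exp (C * (M + δ) * (t - s)) * ∫ x, weight (bumpOf ε hε) g q (strainFlat (u s) x) := h1
          _ ≤ Real.exp (C * (M + δ) * (t - s)) * ∫ x, (g (strainFlat (u s) x) + 3 * ε) ^ q :=
              mul_le_mul_of_nonneg_left (hupp ε hε s (hJsub hs)) hexp.le)
    simpa only [hU0 s (hJsub hs)] using h
  -- Step 4: slopes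
  exact le_of_exp_bounds hab ht hR hJmem hup hdown

/-- **Rows `ES.lam1.q|T_C|C1` (K0 family `ES`, core `lam1`) HOLD for every real `q > 1` (kernel):**
`∃ C ≥ 0, TopEigMomentRateSupBound q C` on `T³ = UnitAddTorus (Fin 3)`.
[ours; closes the DERIVATIVES §29 located gap for `λ₁`] -/
theorem topEigMomentRateSupBound_of_one_lt {q : ℝ} (hq : 1 < q) :
    ∃ C : ℝ, 0 ≤ C ∧ TopEigMomentRateSupBound (d := Fin 3) q C :=
  functionalRateSupBound_of_admissible hq convexOn_lam lipschitzWith_lam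
    (fun _ hv hdiv x => lam_strainFlat_nonneg hv hdiv x)
    (fun _ hv hdiv x => norm_strainFlat_le hv hdiv x)
    (fun _ hv hdiv => torusTopEigMoment_eq hv hdiv q)

/-- **Rows `ES.neglam3.q|T_C|C1` (K0 family `ES`, core `neglam3`) HOLD for every real `q > 1`
(kernel):** `∃ C ≥ 0, NegBotEigMomentRateSupBound q C` on `T³`. [ours] -/
theorem negBotEigMomentRateSupBound_of_one_lt {q : ℝ} (hq : 1 < q) :
    ∃ C : ℝ, 0 ≤ C ∧ NegBotEigMomentRateSupBound (d := Fin 3) q C :=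
  functionalRateSupBound_of_admissible hq convexOn_lam_neg lipschitzWith_lam_neg
    (fun _ hv hdiv x => lam_neg_strainFlat_nonneg hv hdiv x)
    (fun _ hv hdiv x => norm_strainFlat_le_lam_neg hv hdiv x)
    (fun _ hv hdiv => torusNegBotEigMoment_eq hv hdiv q)

/-- **Row `ES.lam1.q=3/2|T_C|C1`** (kernel, control). [ours] -/
theorem topEigMomentRateSupBound_three_halves :
    ∃ C : ℝ, 0 ≤ C ∧ TopEigMomentRateSupBound (d := Fin 3) (3 / 2) C :=
  topEigMomentRateSupBound_of_one_lt (by norm_num)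

/-- **Row `ES.lam1.q=2|T_C|C1`** (kernel, control). [ours] -/
theorem topEigMomentRateSupBound_two :
    ∃ C : ℝ, 0 ≤ C ∧ TopEigMomentRateSupBound (d := Fin 3) 2 C :=
  topEigMomentRateSupBound_of_one_lt (by norm_num)

/-- **Row `ES.lam1.q=3|T_C|C1`** (kernel, control). [ours] -/
theorem topEigMomentRateSupBound_three :
    ∃ C : ℝ, 0 ≤ C ∧ TopEigMomentRateSupBound (d := Fin 3) 3 C :=
  topEigMomentRateSupBound_of_one_lt (by norm_num)

/-- **Row `ES.lam1.q=4|T_C|C1`** (kernel, control). [ours] -/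
theorem topEigMomentRateSupBound_four :
    ∃ C : ℝ, 0 ≤ C ∧ TopEigMomentRateSupBound (d := Fin 3) 4 C :=
  topEigMomentRateSupBound_of_one_lt (by norm_num)

/-- **Rows `ES.neglam3.q|T_C|C1`, `q = 3/2, 2, 3, 4`** (kernel, control). [ours] -/
theorem negBotEigMomentRateSupBound_rows :
    (∃ C : ℝ, 0 ≤ C ∧ NegBotEigMomentRateSupBound (d := Fin 3) (3 / 2) C) ∧
    (∃ C : ℝ, 0 ≤ C ∧ NegBotEigMomentRateSupBound (d := Fin 3) 2 C) ∧
    (∃ C : ℝ, 0 ≤ C ∧ NegBotEigMomentRateSupBound (d := Fin 3) 3 C) ∧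
    (∃ C : ℝ, 0 ≤ C ∧ NegBotEigMomentRateSupBound (d := Fin 3) 4 C) :=
  ⟨negBotEigMomentRateSupBound_of_one_lt (by norm_num), negBotEigMomentRateSupBound_of_one_lt (by norm_num),
    negBotEigMomentRateSupBound_of_one_lt (by norm_num), negBotEigMomentRateSupBound_of_one_lt (by norm_num)⟩

end TopEig

end Summit.NavierStokesRegularity.FunctionalMining

end
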